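import Literature.Geometry.Riemannian.GromovW1Triangle
import Literature.Geometry.Riemannian.WassersteinW1Complete
import Mathlib.Topology.MetricSpace.Gluing
import Mathlib.Topology.MetricSpace.Completion
import HarnessLib

/-!
# `(𝕄, d_{GW₁})` is complete (Bamler 2023, §2.4, Theorem)

R. Bamler, *Compactness theory of the space of super Ricci flows*, Invent. Math. 233 (2023), §2.4,
Theorem: *"`(𝕄, d_{GW_p})` is a complete metric space if we allow the distance to attain `∞`"*,
here for `p = 1` and in the form: every `d_{GW₁}`-Cauchy sequence of metric measure spaces
(probability measures on complete separable metric spaces) `d_{GW₁}`-converges to a metric measure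
space. Printed proof, followed step by step: pass to a subsequence with
`d_{GW₁}(Xᵢ, X_{i+1}) ≤ 2^{-i}`; choose isometric embeddings `φ_{i,−} : Xᵢ → Z_{i,i+1}`,
`φ_{i+1,+} : X_{i+1} → Z_{i,i+1}` with `d^{Z_{i,i+1}}_{W₁} ≤ 2^{-i+1}`; *"By Lemma (combining
isometric embeddings), we may assume that `Z_{1,2} = Z_{2,3} = … =: Z` and `φ_{i,−} = φ_{i,+} =: φᵢ`"*
(iterated gluing `Metric.GlueSpace` and the inductive limit `Metric.InductiveLimit`, as in
Mathlib's completeness of the Gromov–Hausdorff space); *"By passing to the completion of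
`⋃ φᵢ(Xᵢ)`, we may moreover assume that `(Z, d_Z)` is complete and separable"*; then
`(φᵢ)_* μᵢ → μ'_∞` in `W₁` (`WassersteinW1Complete.lean`) and
`d_{GW₁}(Xᵢ, (Z, μ'_∞)) ≤ d^Z_{W₁}((φᵢ)_* μᵢ, μ'_∞) → 0`; a Cauchy sequence with a convergent
subsequence converges (triangle inequality, `GromovW1Triangle.lean`).

* `GlueStruct`, `glueSeq`, `exists_isometry_seq_comm` — **combining countably many isometric
  embeddings**;
* `wassersteinW1_le_wassersteinW1_map_isometry` — `d^S_{W₁}(α, β) ≤ d^T_{W₁}(ι_* α, ι_* β)` for an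
  isometric embedding `ι` of a Polish `S` (restriction of couplings);
* `exists_lt_of_gromovW1_lt` — unpacking `d_{GW₁} < c` into embeddings;
* `gromovW1_completeness` — **the Theorem**.

Everything is proved; the only definitions are the gluing structure and sequence; no named facts.

## References

* R. H. Bamler, *Compactness theory of the space of super Ricci flows*, Invent. Math. 233 (2023),
  §2.4, Theorem (`(𝕄, d_{GW_p})` is complete) and Lemma (combining isometric embeddings).
  [Bamler2023]
* A. Greven, P. Pfaffelhuber, A. Winter, *Convergence in distribution of random metric measure
  spaces*, PTRF 145 (2009) and K.-T. Sturm, *On the geometry of metric measure spaces I*, Acta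
  Math. 196 (2006) — the sources Bamler cites for the argument. [Sturm2006]
-/

noncomputable section

open Set MeasureTheory Filter Topology Metric Function TopologicalSpace
open scoped ENNReal NNReal

namespace Literature.Geometry.Riemannian

universe u

/-! ### Combining countably many isometric embeddings -/

/-- An isometric embedding of `A` into some metric space (Mathlib's
`GromovHausdorff.AuxGluingStruct` in a general universe). [cite: Bamler2023, §2.4, Lemma (combining isometric embeddings)] -/
structure GlueStruct (A : Type u) [MetricSpace A] : Type (u + 1) where
  /-- the ambient space -/
  Space : Type u
  /-- its metric -/
  metric : MetricSpace Space
  /-- the embedding -/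
  embed : A → Space
  /-- which is isometric -/
  isom : Isometry embed

attribute [local instance] GlueStruct.metric

/-- The trivial embedding `A → A`. [cite: Bamler2023, §2.4, Lemma (combining isometric embeddings)] -/
instance (A : Type u) [MetricSpace A] : Inhabited (GlueStruct A) :=
  ⟨{ Space := A, metric := inferInstance, embed := id, isom := fun _ _ ↦ rfl }⟩

/-- **The successive gluing** `Y₀ := Z₀`, `Y_{k+1} := Y_k ⊔_{X_{k+1}} Z_{k+1}` (glued along the two
isometric copies of `X_{k+1}`, `Metric.GlueSpace`), recording the embedding of `Z_k` into `Y_k`.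
[cite: Bamler2023, §2.4, Lemma (combining isometric embeddings)] -/
def glueSeq {X : ℕ → Type u} [∀ k, MetricSpace (X k)] [∀ k, Nonempty (X k)]
    (Z : ℕ → Type u) [∀ k, MetricSpace (Z k)] (φm : ∀ k, X k → Z k) (φp : ∀ k, X (k + 1) → Z k)
    (hφm : ∀ k, Isometry (φm k)) (hφp : ∀ k, Isometry (φp k)) (n : ℕ) : GlueStruct (Z n) :=
  Nat.recOn n default fun k Y ↦
    { Space := GlueSpace (Y.isom.comp (hφp k)) (hφm (k + 1))
      metric := inferInstance
      embed := toGlueR (Y.isom.comp (hφp k)) (hφm (k + 1))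
      isom := toGlueR_isometry _ _ }

set_option backward.isDefEq.respectTransparency false in
/-- **Combining countably many isometric embeddings** (Bamler 2023, §2.4, Lemma (combining
isometric embeddings), iterated as in the proof of the Theorem: *"we may assume that
`Z_{1,2} = Z_{2,3} = … =: Z` and `φ_{i,−} = φ_{i,+} =: φᵢ`"*): given isometric embeddings
`φm k : X_k → Z_k`, `φp k : X_{k+1} → Z_k`, there is one metric space `W` with isometric embeddings
`g k : Z_k → W` under which the two copies of each `X_{k+1}` coincide:
`g k ∘ φp k = g (k+1) ∘ φm (k+1)` (inductive limit of the successive gluings).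
[cite: Bamler2023, §2.4, Lemma (combining isometric embeddings)] -/
theorem exists_isometry_seq_comm {X : ℕ → Type u} [∀ k, MetricSpace (X k)] [∀ k, Nonempty (X k)]
    {Z : ℕ → Type u} [∀ k, MetricSpace (Z k)] {φm : ∀ k, X k → Z k} {φp : ∀ k, X (k + 1) → Z k}
    (hφm : ∀ k, Isometry (φm k)) (hφp : ∀ k, Isometry (φp k)) :
    ∃ (W : Type u) (_ : MetricSpace W) (g : ∀ k, Z k → W),
      (∀ k, Isometry (g k)) ∧ ∀ k, g k ∘ φp k = g (k + 1) ∘ φm (k + 1) := by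
  let Y := glueSeq Z φm φp hφm hφp
  have E : ∀ k, GlueSpace ((Y k).isom.comp (hφp k)) (hφm (k + 1)) = (Y (k + 1)).Space :=
    fun k ↦ by dsimp only [Y, glueSeq]
  let c : ∀ k, GlueSpace ((Y k).isom.comp (hφp k)) (hφm (k + 1)) → (Y (k + 1)).Space :=
    fun k ↦ cast (E k)
  have ic : ∀ k, Isometry (c k) := fun k x y ↦ by dsimp only [Y, glueSeq]; exact rfl
  let f : ∀ k, (Y k).Space → (Y (k + 1)).Space :=
    fun k ↦ c k ∘ toGlueL ((Y k).isom.comp (hφp k)) (hφm (k + 1))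
  have I : ∀ k, Isometry (f k) := fun k ↦ (ic k).comp (toGlueL_isometry _ _)
  have hembed : ∀ k, (Y (k + 1)).embed =
      c k ∘ toGlueR ((Y k).isom.comp (hφp k)) (hφm (k + 1)) := fun k ↦ by
    funext z
    dsimp only [Y, glueSeq, c]
    rfl
  refine ⟨Metric.InductiveLimit I, inferInstance, fun k ↦ toInductiveLimit I k ∘ (Y k).embed,
    fun k ↦ (toInductiveLimit_isometry I k).comp (Y k).isom, fun k ↦ ?_⟩
  calc (toInductiveLimit I k ∘ (Y k).embed) ∘ φp k
      = (toInductiveLimit I (k + 1) ∘ f k) ∘ (Y k).embed ∘ φp k := by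
        rw [toInductiveLimit_commute I k]; rfl
    _ = toInductiveLimit I (k + 1) ∘ c k ∘ (toGlueL ((Y k).isom.comp (hφp k)) (hφm (k + 1)) ∘
          ((Y k).embed ∘ φp k)) := rfl
    _ = toInductiveLimit I (k + 1) ∘ c k ∘ (toGlueR ((Y k).isom.comp (hφp k)) (hφm (k + 1)) ∘
          φm (k + 1)) := by rw [toGlue_commute]
    _ = (toInductiveLimit I (k + 1) ∘ (Y (k + 1)).embed) ∘ φm (k + 1) := by rw [hembed]; rfl

/-! ### `d_{W₁}` in a subspace and in the ambient space -/

/-- **`d^S_{W₁}(α, β) ≤ d^T_{W₁}(ι_* α, ι_* β)`** for an isometric embedding `ι : S → T` of a complete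
separable `S` into an arbitrary metric space `T` and probability measures `α, β` on `S`: a coupling
of `ι_* α, ι_* β` restricts to a coupling of `α, β` with the same cost
(`IsCoupling.comap_prodMap`). (With `wassersteinW1_map_le_of_edist_le` this is an equality.)
[cite: Bamler2023, §2.4, proof of the Theorem (passing to the completion of ⋃ φᵢ(Xᵢ))] -/
theorem wassersteinW1_le_wassersteinW1_map_isometry {S : Type*} [MetricSpace S] [MeasurableSpace S]
    [BorelSpace S] [SecondCountableTopology S] [CompleteSpace S] {T : Type*} [MetricSpace T]
    [MeasurableSpace T] [BorelSpace T] {ι : S → T} (hι : Isometry ι) (α β : Measure S)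
    [IsProbabilityMeasure α] [IsProbabilityMeasure β] :
    wassersteinW1 α β ≤ wassersteinW1 (α.map ι) (β.map ι) := by
  have hme : MeasurableEmbedding ι := hι.isClosedEmbedding.measurableEmbedding
  refine le_iInf fun q ↦ ?_
  obtain ⟨q, hq⟩ := q
  obtain ⟨hc, hmap⟩ := hq.comap_prodMap hme hme
  have hcost : ∫⁻ p, edist p.1 p.2 ∂(q.comap (Prod.map ι ι)) = ∫⁻ z, edist z.1 z.2 ∂q := by
    have h := (hme.prodMap hme).lintegral_map (μ := q.comap (Prod.map ι ι))
      (fun z : T × T ↦ edist z.1 z.2)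
    rw [hmap] at h
    rw [h]
    refine lintegral_congr fun p ↦ ?_
    exact (hι.edist_eq p.1 p.2).symm
  exact (wassersteinW1_le_lintegral hc).trans_eq hcost

/-! ### Unpacking `d_{GW₁} < c` -/

/-- If `d_{GW₁}(μ, ν) < c` there are a metric space `Z` and isometric embeddings `φ, ψ` with
`d^Z_{W₁}(φ_* μ, ψ_* ν) < c` (`Z` with its Borel σ-algebra).
[cite: Bamler2023, §2.4, Definition (Gromov–W₁ distance)] -/
theorem exists_lt_of_gromovW1_lt {X Y : Type u} [MetricSpace X] [MeasurableSpace X] [MetricSpace Y]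
    [MeasurableSpace Y] {μ : Measure X} {ν : Measure Y} {c : ℝ≥0∞} (h : gromovW1 μ ν < c) :
    ∃ (Z : Type u) (_ : MetricSpace Z) (φ : X → Z) (ψ : Y → Z), Isometry φ ∧ Isometry ψ ∧
      @wassersteinW1 Z _ (borel Z) (@Measure.map X Z _ (borel Z) φ μ)
        (@Measure.map Y Z _ (borel Z) ψ ν) < c := by
  obtain ⟨Z, h⟩ := iInf_lt_iff.1 h
  obtain ⟨inst, h⟩ := iInf_lt_iff.1 h
  obtain ⟨φ, h⟩ := iInf_lt_iff.1 h
  obtain ⟨ψ, h⟩ := iInf_lt_iff.1 h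
  obtain ⟨hφ, h⟩ := iInf_lt_iff.1 h
  obtain ⟨hψ, h⟩ := iInf_lt_iff.1 h
  exact ⟨Z, inst, φ, ψ, hφ, hψ, h⟩

/-! ### Elementary lemmas on `[0, ∞]`-valued pseudo-distances on `ℕ` -/

/-- Chaining: `d k (k + n) ≤ ∑_{i < n} d (k + i) (k + i + 1)` for a `d` satisfying the triangle
inequality with `d k k = 0`. [folklore] -/
theorem dist_le_sum_of_triangle {d : ℕ → ℕ → ℝ≥0∞} (hself : ∀ k, d k k = 0)
    (htri : ∀ a b c, d a c ≤ d a b + d b c) (k n : ℕ) :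
    d k (k + n) ≤ ∑ i ∈ Finset.range n, d (k + i) (k + i + 1) := by
  induction n with
  | zero => simp [hself]
  | succ n ih =>
      calc d k (k + (n + 1)) ≤ d k (k + n) + d (k + n) (k + n + 1) := by
            rw [← add_assoc]; exact htri _ _ _
        _ ≤ ∑ i ∈ Finset.range n, d (k + i) (k + i + 1) + d (k + n) (k + n + 1) :=
            add_le_add ih le_rfl
        _ = ∑ i ∈ Finset.range (n + 1), d (k + i) (k + i + 1) := by
            rw [Finset.sum_range_succ]

/-- Fast decay implies the Cauchy property: if `d k (k + 1) ≤ 2^{-k}` then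
`d k l < η` for `k, l ≥ N(η)`. [folklore] -/
theorem cauchy_of_le_geometric {d : ℕ → ℕ → ℝ≥0∞} (hself : ∀ k, d k k = 0)
    (hcomm : ∀ a b, d a b = d b a) (htri : ∀ a b c, d a c ≤ d a b + d b c)
    (hd : ∀ k, d k (k + 1) ≤ 2⁻¹ ^ k) {η : ℝ≥0∞} (hη : 0 < η) :
    ∃ N, ∀ k ≥ N, ∀ l ≥ N, d k l < η := by
  -- tail bound `d k (k + n) ≤ 2 · 2^{-k}`
  have htail : ∀ k n, d k (k + n) ≤ 2 * 2⁻¹ ^ k := fun k n ↦ by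
    calc d k (k + n) ≤ ∑ i ∈ Finset.range n, d (k + i) (k + i + 1) :=
          dist_le_sum_of_triangle hself htri k n
      _ ≤ ∑ i ∈ Finset.range n, (2⁻¹ : ℝ≥0∞) ^ (k + i) := Finset.sum_le_sum fun i _ ↦ hd (k + i)
      _ ≤ ∑' i, (2⁻¹ : ℝ≥0∞) ^ (k + i) := ENNReal.sum_le_tsum _
      _ = 2⁻¹ ^ k * ∑' i, (2⁻¹ : ℝ≥0∞) ^ i := by
          rw [← ENNReal.tsum_mul_left]
          exact tsum_congr fun i ↦ by rw [pow_add]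
      _ = 2 * 2⁻¹ ^ k := by
          rw [ENNReal.tsum_geometric, ENNReal.one_sub_inv_two, inv_inv, mul_comm]
  -- choose `N` with `2 · 2^{-N} < η`
  obtain ⟨N, hN⟩ := ENNReal.exists_inv_two_pow_lt (ENNReal.half_pos hη.ne').ne'
  have hN' : 2 * (2⁻¹ : ℝ≥0∞) ^ N < η := by
    rw [mul_comm]
    exact ENNReal.mul_lt_of_lt_div hN
  have hmono : ∀ {k}, N ≤ k → 2 * (2⁻¹ : ℝ≥0∞) ^ k ≤ 2 * 2⁻¹ ^ N := fun {k} hk ↦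
    mul_le_mul_of_nonneg_left (pow_le_pow_right_of_le_one' (by norm_num) hk) bot_le
  refine ⟨N, fun k hk l hl ↦ ?_⟩
  rcases le_total k l with hkl | hlk
  · obtain ⟨n, rfl⟩ := Nat.exists_eq_add_of_le hkl
    exact (htail k n).trans_lt ((hmono hk).trans_lt hN')
  · obtain ⟨n, rfl⟩ := Nat.exists_eq_add_of_le hlk
    rw [hcomm]
    exact (htail l n).trans_lt ((hmono hl).trans_lt hN')

/-- Extraction of a fast subsequence from a Cauchy sequence: `G (φ k) (φ (k+1)) < 2^{-k}`.
[folklore] -/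
theorem exists_strictMono_lt_of_cauchy {G : ℕ → ℕ → ℝ≥0∞}
    (hC : ∀ ε : ℝ≥0∞, 0 < ε → ∃ N, ∀ i ≥ N, ∀ j ≥ N, G i j < ε) :
    ∃ φ : ℕ → ℕ, StrictMono φ ∧ ∀ k, G (φ k) (φ (k + 1)) < 2⁻¹ ^ k := by
  have hpos : ∀ k : ℕ, (0 : ℝ≥0∞) < 2⁻¹ ^ k := fun k ↦ ENNReal.pow_pos (by norm_num) k
  choose N hN using fun k ↦ hC (2⁻¹ ^ k) (hpos k)
  let φ : ℕ → ℕ := fun k ↦ Nat.rec (N 0) (fun k n ↦ max (n + 1) (N (k + 1))) k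
  have hφN : ∀ k, N k ≤ φ k := by
    intro k
    cases k with
    | zero => exact le_rfl
    | succ k => exact le_max_right _ _
  have hφlt : ∀ k, φ k < φ (k + 1) := fun k ↦
    Nat.lt_of_lt_of_le (Nat.lt_succ_self _) (le_max_left _ _)
  exact ⟨φ, strictMono_nat_of_lt_succ hφlt, fun k ↦
    hN k _ (hφN k) _ ((hφN k).trans (hφlt k).le)⟩

/-- A type carrying a probability measure is nonempty. [folklore] -/
theorem nonempty_of_isProbabilityMeasure' {X : Type*} [MeasurableSpace X] (μ : Measure X)
    [IsProbabilityMeasure μ] : Nonempty X := by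
  by_contra hX
  rw [not_nonempty_iff] at hX
  have h1 : μ univ = 1 := measure_univ
  rw [univ_eq_empty_iff.2 hX, measure_empty] at h1
  exact zero_ne_one h1

/-! ### The Theorem -/

/-- **`(𝕄, d_{GW₁})` is complete** (Bamler 2023, §2.4, Theorem; `p = 1`): a sequence of metric
measure spaces `(Xᵢ, dᵢ, μᵢ)` (probability measures on complete separable metric spaces, in one
universe) which is Cauchy for `d_{GW₁}` converges in `d_{GW₁}` to a metric measure space
`(S, d_S, ρ)` with `S` complete and separable — here `S` is the closure of `⋃ᵢ φᵢ(Xᵢ)` in the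
completion of the common space `Z` of the printed proof and `ρ = μ'_∞` the `W₁`-limit of
`(φᵢ)_* μᵢ` (the printed proof further restricts to `supp μ'_∞`, which does not change the class
in `𝕄`). [cite: Bamler2023, §2.4, Theorem ((𝕄, d_{GW_p}) is complete)] -/
theorem gromovW1_completeness {X : ℕ → Type u} [∀ i, MetricSpace (X i)]
    [∀ i, MeasurableSpace (X i)] [∀ i, BorelSpace (X i)] [∀ i, SecondCountableTopology (X i)]
    [∀ i, CompleteSpace (X i)] (μ : ∀ i, Measure (X i)) [∀ i, IsProbabilityMeasure (μ i)]
    (hC : ∀ ε : ℝ≥0∞, 0 < ε → ∃ N, ∀ i ≥ N, ∀ j ≥ N, gromovW1 (μ i) (μ j) < ε) :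
    ∃ (S : Type u) (_ : MetricSpace S) (_ : MeasurableSpace S) (_ : BorelSpace S)
      (_ : SecondCountableTopology S) (_ : CompleteSpace S) (ρ : Measure S),
      IsProbabilityMeasure ρ ∧ Tendsto (fun i ↦ gromovW1 (μ i) ρ) atTop (𝓝 0) := by
  haveI : ∀ i, Nonempty (X i) := fun i ↦ nonempty_of_isProbabilityMeasure' (μ i)
  -- Step 1: a fast subsequence, `d_{GW₁}(X_{φ k}, X_{φ (k+1)}) < 2^{-k}`
  obtain ⟨φ, hφ, hfast⟩ := exists_strictMono_lt_of_cauchy hC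
  -- Step 2: embeddings realising the consecutive distances
  have hex : ∀ k, ∃ (Z : Type u) (_ : MetricSpace Z) (f : X (φ k) → Z) (g : X (φ (k + 1)) → Z),
      Isometry f ∧ Isometry g ∧ @wassersteinW1 Z _ (borel Z)
        (@Measure.map (X (φ k)) Z _ (borel Z) f (μ (φ k)))
        (@Measure.map (X (φ (k + 1))) Z _ (borel Z) g (μ (φ (k + 1)))) < 2⁻¹ ^ k :=
    fun k ↦ exists_lt_of_gromovW1_lt (hfast k)
  choose Z instZ φm φp hφm hφp hW using hex
  letI : ∀ k, MetricSpace (Z k) := instZ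
  letI : ∀ k, MeasurableSpace (Z k) := fun k ↦ borel (Z k)
  haveI : ∀ k, BorelSpace (Z k) := fun k ↦ ⟨rfl⟩
  -- Step 3: one common space (combining the embeddings)
  obtain ⟨W, instW, g, hg, hcomm⟩ :=
    exists_isometry_seq_comm (X := fun k ↦ X (φ k)) (Z := Z) hφm hφp
  letI := instW
  letI : MeasurableSpace W := borel W
  haveI : BorelSpace W := ⟨rfl⟩
  have he : ∀ k, Isometry (g k ∘ φm k) := fun k ↦ (hg k).comp (hφm k)
  have hW₁ : ∀ k, wassersteinW1 ((μ (φ k)).map (g k ∘ φm k))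
      ((μ (φ (k + 1))).map (g (k + 1) ∘ φm (k + 1))) < 2⁻¹ ^ k := by
    intro k
    rw [← Measure.map_map (hg k).continuous.measurable (hφm k).continuous.measurable,
      ← hcomm k,
      ← Measure.map_map (hg k).continuous.measurable (hφp k).continuous.measurable]
    exact (wassersteinW1_map_le_of_edist_le (hg k).continuous.measurable
      (fun a b ↦ ((hg k).edist_eq a b).le) _ _).trans_lt (hW k)
  -- Step 4: the completion and the closed separable subspace `S = closure ⋃ range`
  let Wc := UniformSpace.Completion W
  letI : MeasurableSpace Wc := borel Wc
  haveI : BorelSpace Wc := ⟨rfl⟩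
  have hι : Isometry ((↑) : W → Wc) := UniformSpace.Completion.coe_isometry
  have hec : ∀ k, Isometry (((↑) : W → Wc) ∘ (g k ∘ φm k)) := fun k ↦ hι.comp (he k)
  set S : Set Wc := closure (⋃ k, range (((↑) : W → Wc) ∘ (g k ∘ φm k))) with hS_def
  haveI : CompleteSpace S := isClosed_closure.isComplete.completeSpace_coe
  have hSsep : IsSeparable S :=
    (IsSeparable.iUnion fun k ↦ isSeparable_range (hec k).continuous).closure
  haveI : SeparableSpace S := hSsep.separableSpace
  haveI : SecondCountableTopology S := UniformSpace.secondCountable_of_separable S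
  set es : ∀ k, X (φ k) → S := fun k x ↦
    ⟨(((↑) : W → Wc) ∘ (g k ∘ φm k)) x, subset_closure (mem_iUnion.2 ⟨k, mem_range_self x⟩)⟩
    with hes_def
  have hes : ∀ k, Isometry (es k) := fun k ↦ Isometry.of_dist_eq fun a b ↦ (hec k).dist_eq a b
  have hval : Isometry ((↑) : S → Wc) := isometry_subtype_coe
  -- the pushed-forward measures in `S`
  set ρ : ℕ → Measure S := fun k ↦ (μ (φ k)).map (es k) with hρ_def
  haveI : ∀ k, IsProbabilityMeasure (ρ k) := fun k ↦
    Measure.isProbabilityMeasure_map (hes k).continuous.measurable.aemeasurable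
  have hρ : ∀ k, wassersteinW1 (ρ k) (ρ (k + 1)) < 2⁻¹ ^ k := by
    intro k
    refine (wassersteinW1_le_wassersteinW1_map_isometry hval (ρ k) (ρ (k + 1))).trans_lt ?_
    have h1 : ∀ j, (ρ j).map ((↑) : S → Wc) =
        ((μ (φ j)).map (g j ∘ φm j)).map ((↑) : W → Wc) := fun j ↦ by
      rw [hρ_def, Measure.map_map hval.continuous.measurable (hes j).continuous.measurable,
        Measure.map_map hι.continuous.measurable (he j).continuous.measurable]
      rfl
    rw [h1, h1]
    exact (wassersteinW1_map_le_of_edist_le hι.continuous.measurable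
      (fun a b ↦ (hι.edist_eq a b).le) _ _).trans_lt (hW₁ k)
  -- Step 5: the `W₁`-limit in the Polish space `S`
  have hCauchy : ∀ η : ℝ≥0∞, 0 < η → ∃ N, ∀ k ≥ N, ∀ l ≥ N, wassersteinW1 (ρ k) (ρ l) < η :=
    fun η hη ↦ cauchy_of_le_geometric (d := fun k l ↦ wassersteinW1 (ρ k) (ρ l))
      (fun k ↦ wassersteinW1_self _) (fun a b ↦ wassersteinW1_comm _ _)
      (fun a b c ↦ wassersteinW1_triangle _ _ _) (fun k ↦ (hρ k).le) hη
  obtain ⟨ρlim, hρlimP, hlim⟩ := exists_tendsto_wassersteinW1_nhds_zero_of_cauchySeq hCauchy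
  -- Step 6: `d_{GW₁}`-convergence of the subsequence …
  have hsub : Tendsto (fun k ↦ gromovW1 (μ (φ k)) ρlim) atTop (𝓝 0) := by
    refine tendsto_of_tendsto_of_tendsto_of_le_of_le tendsto_const_nhds hlim (fun _ ↦ bot_le)
      fun k ↦ ?_
    have h := gromovW1_le_wassersteinW1_map (μ (φ k)) ρlim (hes k) isometry_id
    rwa [Measure.map_id] at h
  -- … and of the whole sequence
  refine ⟨S, inferInstance, inferInstance, inferInstance, inferInstance, inferInstance, ρlim,
    hρlimP, ?_⟩
  rw [ENNReal.tendsto_atTop_zero]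
  intro η hη
  obtain ⟨N₁, hN₁⟩ := hC (η / 2) (ENNReal.half_pos hη.ne')
  rw [ENNReal.tendsto_atTop_zero] at hsub
  obtain ⟨K, hK⟩ := hsub (η / 2) (ENNReal.half_pos hη.ne')
  refine ⟨N₁, fun i hi ↦ ?_⟩
  have hk2 : N₁ ≤ φ (max K N₁) := (le_max_right _ _).trans (hφ.id_le _)
  calc gromovW1 (μ i) ρlim
      ≤ gromovW1 (μ i) (μ (φ (max K N₁))) + gromovW1 (μ (φ (max K N₁))) ρlim :=
        gromovW1_triangle _ _ _
    _ ≤ η / 2 + η / 2 := add_le_add (hN₁ i hi _ hk2).le (hK _ (le_max_left _ _))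
    _ = η := ENNReal.add_halves η

end Literature.Geometry.Riemannian

end
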